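import Summits.ResolutionOfSingularities.ResolutionOfSingularities.Theorems.MarkedTransferCampaignW46WWalkPortableThread
import Summits.ResolutionOfSingularities.ResolutionOfSingularities.Theorems.MarkedTransferCampaignW46WWalkPortableDoor
import Summits.ResolutionOfSingularities.ResolutionOfSingularities.Theorems.MarkedTransferCampaignW46WWalkNRRoot
import Mathlib.FieldTheory.IsAlgClosed.AlgebraicClosure
import HarnessLib

/-!
# [OURS · L1 W4.6 rung (iii)] RUNG (iii) OVER EVERY PERFECT FIELD: the typed procedure's permissible sequences terminate inside o1's regime
# of record `regimeMohWindowSurfaceInsep` (purely inseparable surface Moh window, NON-PI residuals included), every characteristic `p`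

Cell `res-hironaka`, LADDER-RESOLUTION rung L (D-0089), slot W4.6 rung (iii); seat res-L1-s46-pv-5 (gen 7). Host route MarkedTransfer,
`--supports stmt-ResolutionOfSingularities-16155 --as helper`; kind proof (def-free). Plan `HOME/L/res-L1-s46-pv-5/NOTES.md` (gen 7, file F6).
Gen 6 (`…WWalkTerminates`) proved the rung over ALGEBRAICALLY CLOSED fields; this file removes that hypothesis.

WHAT IS PROVED (all OURS).
* `false_of_hitThread_wAnchor_nr` — an infinite §2.1-permissible sequence inside `regimeMohWindowSurfaceInsep` with a hit thread whose root
  carries a `w`-anchor over a perfect field `L₀` embedded in an algebraically closed `Ω` does not exist. Along the thread the W-walk is carried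
  by `…WWalkPortableThread.wAnchor_succ_nr` (anchors over the residue fields `L_k`, growing; model states read in `Ω⟦t,y,z⟧`); the hit stages
  form an infinite model walk over `Ω` satisfying the hypotheses of gen 6's `…WWalkCombinatorics.eventually_tStep` (window and (ND) from
  pv-6's `WWalkNR.residual_facts`, boundary exponents `< p` from `WWalkNR.bdiv_lt_of_wAnchor`), so from some hit on every step is a `T`-step; the `T`-tail
  contradicts gen 6's `…WWalkEndgame.false_of_tTail` IN `Ω⟦t,y,z⟧`, whose door hypothesis is THE PORTABLE DOOR
  (`…WWalkPortableDoor.exists_forall_map_not_mem_span_pair_pow_sup`: the approximate exit at the first tail point, valid over every extension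
  of its residue field). No rationality of the thread points, no Galois theory, no Weierstrass form.
* the ROOT anchor over the (perfect) residue field of the root is res-L1-s46-pv-6 (gen 8)'s `…WWalkNRRoot.exists_wAnchor_start_nr` (landed in
  parallel with this seat's identical draft — imported, not forked).
* **`mohWindowSurfaceInsepPermissiblyTerminates_of_perfectField [PerfectField K] : MohWindowSurfaceInsepPermissiblyTerminates p K`** — RUNG (iii)
  for o1's regime of record over EVERY PERFECT FIELD, every `p` (`Ω :=` an algebraic closure of the root's residue field); typed forms
  `terminates_regimeMohWindowSurfaceInsep_of_perfectField`, `terminatesNabla_regimeMohWindowSurfaceInsep_of_perfectField` (every notion instance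
  and reading; the formally-PI sub-rung over every perfect field is res-L1-s46-pv-6's p564242).

HONEST FRAMING. OURS; nothing here is a statement of H. Hironaka's manuscript [Hironaka2017] (Th. 16.6 p.84, Th. 16.13 p.87 — scope only, under
adjudication) and nothing of it is used; no FACT-LIST premise. `K` PERFECT is used twice: the door (differential order criterion) and the
separability of the residue fields of closed points (Cohen coordinates over `K`, perfect coefficient fields for Hensel). NOT CLAIMED: imperfect
`K`. AI-written; AI review is weaker than expert review. No `sorry`; axioms standard. References: Stacks Project Tags 0804, 01TB [StacksProject];
H. Hauser, Bull. AMS 47 (2010) §§F–G [Hauser2010]; H. Matsumura (1986) Thm. 28.3, 29.7 [Matsumura1987].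
-/

noncomputable section

set_option linter.dupNamespace false -- mandated namespace of this single-conjunct summit

open MvPowerSeries IsLocalRing Finset
open Literature.AlgebraicGeometry.Resolution
open Literature.RingTheory.MvPowerSeries.Jets (mem_maximalIdeal_iff_constantCoeff_eq_zero mem_maximalIdeal_pow_iff)

namespace Summit.ResolutionOfSingularities.ResolutionOfSingularities.Theorems

namespace CampaignW46

namespace WWalk

open CategoryTheory AlgebraicGeometry TopologicalSpace
open Literature.AlgebraicGeometry.Hironaka2017.S02Preliminaries
open Literature.AlgebraicGeometry.Hironaka2017.Datum
open Scheme.IdealSheafData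
open CampaignW46.MohWindowShadeFormalNR (order_map_of_injective)

variable {p : ℕ} [hp : Fact p.Prime] {K : Type} [Field K] [CharP K p] [PerfectField K]

/-! ## §1 No hit thread with an anchored root -/

section Walk

variable {Ω : Type} [Field Ω] [IsAlgClosed Ω] [DecidableEq Ω] [CharP Ω p]

/-- **THE W-WALK OVER A PERFECT FIELD CLOSES ON THE PORTABLE DOOR.** See the module docstring. [cite: StacksProject, Tag 0804]
[cite: Hauser2010, §§F–G] -/
theorem false_of_hitThread_wAnchor_nr (r : PermissibleRun p K)
    (hr : ∀ k, regimeMohWindowSurfaceInsep (p := p) (K := K) (r.A k) (r.E k)) (t : r.HitThread)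
    (FR : MvPowerSeries (Option (Fin 2)) Ω) (hFR : LowVanish (p + 1) FR)
    (hA0 : ∃ (L : Type) (_ : Field L) (_ : CharP L p) (_ : PerfectField L) (ι : L →+* Ω)
      (e : AdicCompletion (maximalIdeal ((r.A 0).Z.presheaf.stalk (t.y 0))) ((r.A 0).Z.presheaf.stalk (t.y 0)) ≃+* MvPowerSeries (Option (Fin 2)) L)
      (f₀ : (r.A 0).Z.presheaf.stalk (t.y 0)) (w f : MvPowerSeries (Option (Fin 2)) L),
      stalkIdeal (r.E 0).J (t.y 0) = Ideal.span {f₀} ∧ IsUnit w ∧ e (algebraMap _ _ f₀) = w * (X none ^ p + f) ∧ MvPowerSeries.map ι f = FR) :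
    False := by
  classical
  have hp2 : 2 ≤ p := hp.out.two_le
  -- the anchor predicate at stage `k` for a model state `(F, r_t, r_y)` read in `Ω`
  let St := MvPowerSeries (Option (Fin 2)) Ω × ℕ × ℕ
  let Anch : ℕ → St → Prop := fun k s =>
    (∃ (L : Type) (_ : Field L) (_ : CharP L p) (_ : PerfectField L) (ι : L →+* Ω)
      (e : AdicCompletion (maximalIdeal ((r.A k).Z.presheaf.stalk (t.y k))) ((r.A k).Z.presheaf.stalk (t.y k)) ≃+* MvPowerSeries (Option (Fin 2)) L)
      (f₀ : (r.A k).Z.presheaf.stalk (t.y k)) (w f : MvPowerSeries (Option (Fin 2)) L),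
      stalkIdeal (r.E k).J (t.y k) = Ideal.span {f₀} ∧ IsUnit w ∧ e (algebraMap _ _ f₀) = w * (X none ^ p + f) ∧ MvPowerSeries.map ι f = s.1) ∧
    LowVanish (p + 1) s.1 ∧ BDiv s.2.1 s.2.2 s.1
  -- one step, by `wAnchor_succ_nr`
  have G : ∀ (k : ℕ) (P : {s : St // Anch k s}), ∃ (Q : {s : St // Anch (k + 1) s}) (v : Bool) (l γ : Ω),
      ((r.D k : Set (r.A k).Z) = {t.y k} →
        (v = false → Q.1.1 = stepT p l γ P.1.1 ∧ Q.1.2.1 = P.1.1.order.toNat - p ∧ Q.1.2.2 = (if l = 0 then P.1.2.2 else 0) ∧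
          (l = 0 → 0 < P.1.2.2 → γ = 0)) ∧
        (v = true → Q.1.1 = stepT p 0 γ (swapTY P.1.1) ∧ Q.1.2.1 = P.1.1.order.toNat - p ∧ Q.1.2.2 = P.1.2.1 ∧
          (0 < P.1.2.1 → γ = 0))) ∧
      ((r.D k : Set (r.A k).Z) ≠ {t.y k} → Q.1 = P.1) := by
    intro k P
    obtain ⟨hA, hP2, hB⟩ := P.2
    obtain ⟨F', rt', ry', v, l, γ, h1, h2, hA', hP2', hB'⟩ := wAnchor_succ_nr r hr t k P.1.1 P.1.2.1 P.1.2.2 hA hP2 hB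
    refine ⟨⟨(F', rt', ry'), hA', hP2', hB'⟩, v, l, γ, h1, fun h => ?_⟩
    obtain ⟨e1, e2, e3⟩ := h2 h
    change (F', rt', ry') = P.1
    rw [e1, e2, e3]
  choose next nv nl nγ hnext using G
  let seq : ∀ k, {s : St // Anch k s} :=
    fun k => Nat.rec (motive := fun k => {s : St // Anch k s}) ⟨(FR, 0, 0), hA0, hFR, fun _ _ => ⟨Nat.zero_le _, Nat.zero_le _⟩⟩
      (fun k P => next k P) k
  have hseq : ∀ k, seq (k + 1) = next k (seq k) := fun k => rfl
  -- the hit stages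
  set P : ℕ → Prop := fun k => (r.D k : Set (r.A k).Z) = {t.y k} with hP
  have hinf : (setOf P).Infinite :=
    Nat.frequently_atTop_iff_infinite.mp (Filter.frequently_atTop.mpr fun a => t.hit a)
  have hPnth : ∀ n, P (Nat.nth P n) := Nat.nth_mem_of_infinite hinf
  have hgap : ∀ n m, Nat.nth P n < m → m < Nat.nth P (n + 1) → ¬ P m := by
    intro n m h1 h2 hm
    obtain ⟨i, -, hi⟩ := Nat.exists_lt_card_nth_eq hm
    rw [← hi] at h1 h2
    have := (Nat.nth_lt_nth hinf).mp h1
    have := (Nat.nth_lt_nth hinf).mp h2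
    omega
  -- the state is constant off the hit stages
  have hstay : ∀ m, ¬ P m → (seq (m + 1)).1 = (seq m).1 := fun m hm => by
    rw [hseq]; exact (hnext m (seq m)).2 hm
  have hconst : ∀ n d, Nat.nth P n + 1 + d ≤ Nat.nth P (n + 1) →
      (seq (Nat.nth P n + 1 + d)).1 = (seq (Nat.nth P n + 1)).1 := by
    intro n d
    induction d with
    | zero => intro _; rfl
    | succ d ih =>
      intro hle
      have h1 : (seq (Nat.nth P n + 1 + d + 1)).1 = (seq (Nat.nth P n + 1 + d)).1 :=
        hstay _ (hgap n _ (by omega) (by omega))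
      rw [← ih (by omega), ← h1]
      rfl
  -- the model walk, indexed by the hits
  set fM : ℕ → MvPowerSeries (Option (Fin 2)) Ω := fun n => (seq (Nat.nth P n)).1.1 with hfM
  set rtM : ℕ → ℕ := fun n => (seq (Nat.nth P n)).1.2.1 with hrtM
  set ryM : ℕ → ℕ := fun n => (seq (Nat.nth P n)).1.2.2 with hryM
  set vM : ℕ → Bool := fun n => nv (Nat.nth P n) (seq (Nat.nth P n)) with hvM
  set lM : ℕ → Ω := fun n => nl (Nat.nth P n) (seq (Nat.nth P n)) with hlM
  set γM : ℕ → Ω := fun n => nγ (Nat.nth P n) (seq (Nat.nth P n)) with hγM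
  have hnextM : ∀ n, (seq (Nat.nth P (n + 1))).1 = (seq (Nat.nth P n + 1)).1 := by
    intro n
    have hlt : Nat.nth P n < Nat.nth P (n + 1) := (Nat.nth_lt_nth hinf).mpr (Nat.lt_succ_self n)
    obtain ⟨d, hd⟩ : ∃ d, Nat.nth P (n + 1) = Nat.nth P n + 1 + d := ⟨Nat.nth P (n + 1) - (Nat.nth P n + 1), by omega⟩
    rw [hd]
    exact hconst n d (by omega)
  have hhitrel : ∀ n,
      (vM n = false → fM (n + 1) = stepT p (lM n) (γM n) (fM n) ∧ rtM (n + 1) = (fM n).order.toNat - p ∧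
        ryM (n + 1) = (if lM n = 0 then ryM n else 0) ∧ (lM n = 0 → 0 < ryM n → γM n = 0)) ∧
      (vM n = true → fM (n + 1) = stepT p 0 (γM n) (swapTY (fM n)) ∧ rtM (n + 1) = (fM n).order.toNat - p ∧
        ryM (n + 1) = rtM n ∧ (0 < rtM n → γM n = 0)) := by
    intro n
    have h := (hnext (Nat.nth P n) (seq (Nat.nth P n))).1 (hPnth n)
    rw [← hseq] at h
    simp only [hfM, hrtM, hryM, hvM, hlM, hγM, hnextM n]
    exact h
  -- per-hit facts from the regime at the hit stage, read over `L_k` and transported to `Ω`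
  have hfacts : ∀ n, ∃ d : ℕ, (fM n).order = d ∧ p + 1 ≤ d ∧ d ≤ 2 * p - 1 ∧ LowVanish d (fM n) ∧
      (∃ a b c, a + b + c = d ∧ coeff (mk3 a b c) (fM n) ≠ 0) ∧ (d - rtM n - ryM n < p → NDz d (fM n)) := by
    intro n
    obtain ⟨⟨L, _, _, _, ι, e, f₀, w, f, hJ, hw, hE, hmap⟩, hP2, hB⟩ := (seq (Nat.nth P n)).2
    have hP2L : LowVanish (p + 1) f := by rw [← lowVanish_map_iff ι.injective]; exact hmap ▸ hP2
    have hBL : BDiv (rtM n) (ryM n) f := by rw [← bdiv_map_iff ι.injective]; exact hmap ▸ hB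
    obtain ⟨d, hd, hpd, hd2, hlow, ⟨a, b, c, habc, hne⟩, hnd⟩ := WWalkNR.residual_facts (hr _) (t.mem _) e hJ hw hE hP2L hBL
    refine ⟨d, ?_, hpd, hd2, ?_, ⟨a, b, c, habc, ?_⟩, fun hσ => ?_⟩
    · change (seq (Nat.nth P n)).1.1.order = d
      rw [← hmap, order_map_of_injective ι ι.injective, hd]
    · change LowVanish d (seq (Nat.nth P n)).1.1
      rw [← hmap, lowVanish_map_iff ι.injective]; exact hlow
    · change coeff (mk3 a b c) (seq (Nat.nth P n)).1.1 ≠ 0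
      rw [← hmap, ne_eq, coeff_map_eq_zero_iff ι.injective]; exact hne
    · change NDz d (seq (Nat.nth P n)).1.1
      rw [← hmap, ndz_map_iff ι.injective]; exact hnd hσ
  choose dM hdM using hfacts
  have hdto : ∀ n, (fM n).order.toNat = dM n := fun n => by rw [(hdM n).1]; rfl
  have hiso : ∀ n, rtM n < p ∧ ryM n < p := by
    intro n
    obtain ⟨⟨L, _, _, _, ι, e, f₀, w, f, hJ, -, hE, hmap⟩, -, hB⟩ := (seq (Nat.nth P n)).2
    have hBL : BDiv (rtM n) (ryM n) f := by rw [← bdiv_map_iff ι.injective]; exact hmap ▸ hB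
    exact WWalkNR.bdiv_lt_of_wAnchor (hr _) e hJ hE hBL
  -- the combinatorial termination: a `T`-tail
  obtain ⟨N, hN⟩ := eventually_tStep hp2 fM rtM ryM dM vM lM γM (fun n => (seq (Nat.nth P n)).2.2.2) (fun n => (hdM n).2.2.2.1)
    (fun n => (hdM n).2.2.2.2.1) (fun n => ⟨(hdM n).2.1, (hdM n).2.2.1⟩) hiso
    (fun n hv => by have h := (hhitrel n).1 hv; rw [hdto] at h; exact h)
    (fun n hv => by have h := (hhitrel n).2 hv; rw [hdto] at h; exact h)
    (fun n => (hdM n).2.2.2.2.2)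
  -- the `T`-tail contradicts the PORTABLE door at the `N`-th hit
  haveI : CharP (MvPowerSeries (Option (Fin 2)) Ω) p := charP_of_injective_ringHom (MvPowerSeries.C_injective) p
  refine false_of_tTail (p := p) (fun k => X none ^ p + fM (N + k)) (fun k => lM (N + k)) (fun k => γM (N + k)) (fun k => ?_)
    (fun k => ?_) ?_
  · -- the step relation
    have hv : vM (N + k) = false := hN _ (by omega)
    have h := ((hhitrel (N + k)).1 hv).1
    rw [show N + (k + 1) = N + k + 1 by omega, h]
    exact (subst_stepS_generator (lM (N + k)) (γM (N + k)) (f := fM (N + k))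
      (fun e he => (seq (Nat.nth P (N + k))).2.2.1 e (by omega))).symm
  · -- order `≥ p`
    intro e he
    rw [map_add, (seq (Nat.nth P (N + k))).2.2.1 e (by omega), add_zero, X_pow_eq, coeff_monomial, if_neg]
    intro h
    rw [h, Finsupp.degree_single] at he
    exact lt_irrefl _ he
  · -- the PORTABLE door at the `N`-th hit
    obtain ⟨⟨L, _, _, _, ι, e, f₀, w, f, hJ, hw, hE, hmap⟩, -, -⟩ := (seq (Nat.nth P N)).2
    obtain ⟨hR, h3, hcl, -, hb⟩ := MohWindowShadeAnchorWalk.regime_point (hr (Nat.nth P N)) (t.mem (Nat.nth P N))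
    obtain ⟨⟨⟨-, hcl'⟩, -⟩, -⟩ := (regimeMohWindowSurfaceInsep_iff _ _).mp (hr (Nat.nth P N))
    obtain ⟨N₀, hN₀⟩ := exists_forall_map_not_mem_span_pair_pow_sup (r.A _) (r.E _) hcl' (by rw [hb]; exact hp.out.pos) hcl h3 e hJ ι
    rw [hb] at hN₀
    refine ⟨N₀, fun u v hu hv hmem => hN₀ u v hu hv ?_⟩
    rw [hE, map_mul]
    refine Ideal.mul_mem_left _ _ ?_
    have : MvPowerSeries.map ι (X none ^ p + f) = X none ^ p + fM N := by
      rw [map_add, map_pow, MvPowerSeries.map_X, hmap]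
    rw [this]
    exact hmem

end Walk

/-! ## §2 The rung over every perfect field -/

/-- **RUNG (iii), PURELY INSEPARABLE SURFACE MOH WINDOW — o1's regime of record, NON-PI residuals included — OVER EVERY PERFECT FIELD, every
characteristic `p`.** There is no infinite §2.1-permissible sequence inside `regimeMohWindowSurfaceInsep`: it would carry a hit thread
(res-L1-s46-pv-1), rooted at a `w`-anchored point over the residue field `L₀` of the root (pv-6's `WWalkNR.exists_wAnchor_start_nr`), against
`false_of_hitThread_wAnchor_nr` with `Ω = L̄₀`. [OURS · L1 W4.6 rung (iii)] NOT a statement of the manuscript. [cite: StacksProject, Tag 0804] -/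
theorem mohWindowSurfaceInsepPermissiblyTerminates_of_perfectField : MohWindowSurfaceInsepPermissiblyTerminates p K := by
  classical
  intro r hr
  obtain ⟨t⟩ := r.nonempty_hitThread fun k => ((regimeMohWindowSurfaceInsep_iff _ _).mp (hr k)).1.1
  obtain ⟨L, _, _, _, e, f₀, w, f, hJ, hw, hE, hfP2⟩ := WWalkNR.exists_wAnchor_start_nr (hr 0) (t.mem 0)
  letI : CharP (AlgebraicClosure L) p := charP_of_injective_algebraMap (algebraMap L (AlgebraicClosure L)).injective p
  exact false_of_hitThread_wAnchor_nr (Ω := AlgebraicClosure L) r hr t (MvPowerSeries.map (algebraMap L (AlgebraicClosure L)) f)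
    ((lowVanish_map_iff (algebraMap L (AlgebraicClosure L)).injective).mpr hfP2)
    ⟨L, inferInstance, inferInstance, inferInstance, algebraMap L (AlgebraicClosure L), e, f₀, w, f, hJ, hw, hE, rfl⟩

/-- **The typed rung (iii) over every perfect field, literal centre rule**: for every `p`, every notion instance and reading, the typed
Th. 16.6 procedure has no infinite run inside `regimeMohWindowSurfaceInsep`. [folklore] -/
theorem terminates_regimeMohWindowSurfaceInsep_of_perfectField (n : ℕ) (N : Notions.{0} n) (Rd : Reading p K N) :
    Terminates N Rd (regimeMohWindowSurfaceInsep (p := p) (K := K)) :=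
  (terminates_and_terminatesNabla_of_mohWindowSurfaceInsepPermissiblyTerminates
    (mohWindowSurfaceInsepPermissiblyTerminates_of_perfectField (p := p) (K := K)) n N Rd).1

/-- **The typed rung (iii) over every perfect field, ∇-centred reading.** [folklore] -/
theorem terminatesNabla_regimeMohWindowSurfaceInsep_of_perfectField (n : ℕ) (N : Notions.{0} n) (Rd : Reading p K N) :
    TerminatesNabla N Rd (regimeMohWindowSurfaceInsep (p := p) (K := K)) :=
  (terminates_and_terminatesNabla_of_mohWindowSurfaceInsepPermissiblyTerminates
    (mohWindowSurfaceInsepPermissiblyTerminates_of_perfectField (p := p) (K := K)) n N Rd).2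

end WWalk

end CampaignW46

end Summit.ResolutionOfSingularities.ResolutionOfSingularities.Theorems

end
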